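import Mathlib
import Summits.ResolutionOfSingularities.ResolutionOfSingularities.Theorems.WildQuotientsWildQuotientResolutionConductorOneToricFan

/-!
# F6 extras: non-vanishing, integrality and birationality of the toric brick
(crux stmt-ResolutionOfSingularities-15640 `WildQuotients.WildQuotientResolution`, line `Sketch`; chain w45c
POST-V5 S2 conductor-𝟙 core, brick F6 `…ConductorOneToricFan` (res-L1-w45c-lead-1 `S2-DESIGN.md` §3/§4):
lemma G `BlowupExit.hasResolution_of_isolated_local_blowups` (F7) consumes local centres `𝔞_Q ≠ ⊥`; this file
gives the generic `J₀ ≠ ⊥` from the HT radical clause, and the integral / birational conjuncts of the fan blow-up.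
[OURS · L1 W4.5c] — NOT a statement of any manuscript. Owner res-L1-w45c-stub-4 (gen 5).)

* `PthCone.X_pow_ne_zero_cone`, `PthCone.irrelevant_ne_bot` — the irrelevant ideal is non-zero once a variable exists;
* `PthCone.ne_bot_of_radical_eq_irrelevant` — any `J₀` with `√J₀ = irrelevant` is non-zero (`n ≥ 1`);
* `PthCone.fanIdeal_ne_bot`, `PthCone.fan_blowup_integral_birational`;
* `ConductorOne.toricBrick_full` — HT with `J₀ ≠ ⊥`, integral, proper, birational recorded (`I` arbitrary, `n ≥ 1`).
No notation.
-/

set_option linter.dupNamespace false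

noncomputable section

open MvPolynomial AlgebraicGeometry
open Literature.AlgebraicGeometry.Resolution

namespace Summit.ResolutionOfSingularities.ResolutionOfSingularities.Theorems.WildQuotientResolution.PthCone

open ConductorOne

variable (k : Type) [Field k] (n p : ℕ) (w : Fin n → ZMod p)

/-- `x_l^e ≠ 0` in the cone. [OURS · L1 W4.5c] -/
theorem X_pow_ne_zero_cone (l : Fin n) {e : ℕ} (he : p ∣ e) :
    (⟨X l ^ e, X_pow_mem_cone_of_dvd k n p w l he⟩ : cone k n p w) ≠ 0 := by
  intro h
  have := congrArg (fun x : cone k n p w => (x : MvPolynomial (Fin n) k)) h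
  simp only [ZeroMemClass.coe_zero] at this
  exact pow_ne_zero e (X_ne_zero l) this

/-- The irrelevant ideal is non-zero as soon as there is a variable (`x_l^p ∈ irrelevant`). [OURS · L1 W4.5c] -/
theorem irrelevant_ne_bot (hp : 0 < p) (l : Fin n) : irrelevant k n p w ≠ ⊥ := by
  intro h
  have hmem : (⟨X l ^ p, X_pow_mem_cone_of_dvd k n p w l dvd_rfl⟩ : cone k n p w) ∈ irrelevant k n p w := by
    rw [mem_irrelevant_iff]
    change constantCoeff ((X l : MvPolynomial (Fin n) k) ^ p) = 0
    rw [map_pow, constantCoeff_X, zero_pow hp.ne']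
  rw [h, Ideal.mem_bot] at hmem
  exact X_pow_ne_zero_cone k n p w l dvd_rfl hmem

/-- **Any HT witness is non-zero**: an ideal `J₀` of the cone with `√J₀ = irrelevant` is `≠ ⊥` (for `n ≥ 1`).
[OURS · L1 W4.5c] -/
theorem ne_bot_of_radical_eq_irrelevant (hp : 0 < p) (l : Fin n) (J : Ideal (cone k n p w))
    (hJ : J.radical = irrelevant k n p w) : J ≠ ⊥ := by
  rintro rfl
  rw [Ideal.radical_bot_of_noZeroDivisors] at hJ
  exact irrelevant_ne_bot k n p w hp l hJ.symm

variable (A : Finset (Fin n)) [hp : Fact p.Prime]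

/-- The fan ideal is non-zero (for `n ≥ 1`). [OURS · L1 W4.5c] -/
theorem fanIdeal_ne_bot (l : Fin n) : fanIdeal n p A k ≠ ⊥ :=
  ne_bot_of_radical_eq_irrelevant k n p _ hp.out.pos l _ (fanIdeal_radical k n p A)

/-- The fan blow-up is integral and birational onto the cone (for `n ≥ 1`). [OURS · L1 W4.5c] -/
theorem fan_blowup_integral_birational (l : Fin n) :
    IsIntegral (affineBlowup (fanIdeal n p A k)) ∧ IsBirational (affineBlowup.π (fanIdeal n p A k)) :=
  ⟨affineBlowup.isIntegral (fanIdeal_ne_bot k n p A l), affineBlowup.isBirational (fanIdeal_ne_bot k n p A l)⟩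

end Summit.ResolutionOfSingularities.ResolutionOfSingularities.Theorems.WildQuotientResolution.PthCone

namespace Summit.ResolutionOfSingularities.ResolutionOfSingularities.Theorems.WildQuotientResolution.ConductorOne

open PthCone

/-- **HT, full record** (`n ≥ 1` witnessed by a variable `l`): the toric brick's `J₀` is non-zero with
`√J₀ = irrelevant`, and `Bl_{J₀}` is regular, integral, proper and birational over the cone. [OURS · L1 W4.5c] -/
theorem toricBrick_full (p : ℕ) (hp : p.Prime) (k : Type) [Field k] (n : ℕ) (l : Fin n) (I : Finset (Fin n)) :
    ∃ J₀ : Ideal (PthCone.cone k n p (chartWeight p n I)), J₀ ≠ ⊥ ∧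
      J₀.radical = PthCone.irrelevant k n p (chartWeight p n I) ∧ Scheme.IsRegular (affineBlowup J₀) ∧
      IsIntegral (affineBlowup J₀) ∧ IsProper (affineBlowup.π J₀) ∧ IsBirational (affineBlowup.π J₀) := by
  haveI : Fact p.Prime := ⟨hp⟩
  exact ⟨fanIdeal n p I k, fanIdeal_ne_bot k n p I l, fanIdeal_radical k n p I, isRegular_affineBlowup_fan k n p I,
    (fan_blowup_integral_birational k n p I l).1, (fan_blowup_regular k n p I).2.2,
    (fan_blowup_integral_birational k n p I l).2⟩

end Summit.ResolutionOfSingularities.ResolutionOfSingularities.Theorems.WildQuotientResolution.ConductorOne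

end
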